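import Summits.ResolutionOfSingularities.ResolutionOfSingularities.Theorems.TightDefectClasses

/-!
# FrameStep (slice 1/4: the polynomial side) — the one-step `K`-frame dictionary of the typed point-blow-up model

(M-Dict) TOOL of the `decomp-res` cell (lens-5, g39) toward `TightDefectClasses.TowerDictionary`
(`MaxContactCut.PolyPureTowersDeep ⟸ TowerDictionary ∧ DefectWalksDeep`), architecture S':
the geometric side of the dictionary is read through **frames** — injective `K`-algebra maps
`θ : K[Z, u] →ₐ[K] L` (`K[Z,u] = MvPolynomial (Option σ) K`, `Z = X none`, `u_m = X (some m)`) into ONE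
ambient field `L` — whose local rings `B(θ) = θ(K[Z,u]_{(Z,u)}) ⊆ L` are the (base-changed) local rings of
the tower, carrying the equations `f = θ(Z^q + F)`.

Main result `frame_step` (pure commutative algebra, no schemes): given a frame `θ`, a residual
polynomial `F` of order `≥ q = pᵉ`, a local `K`-rational subring `B' ⊆ L` certified to be a point
blow-up chart of `B(θ)` (`ShallowPort.PointBlowupCert`) and dominating it, and the controlled-transform
law `θ(Z^q + F) = c^q · g` with `g` in the maximal ideal of `B'`:
* the `Z`-chart is excluded (`f / Z^q` would be a unit);
* there are a chart `u_j`, a point `b` with `b j = 0` and an injective frame `θ'` with `B(θ') = B'`,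
  `θ'(u_j) = θ(u_j)` (the exceptional coordinate) and `θ'(Z^q + F') = unit · g`, where
  `F' = (step q j b s).F = deletePthPowers q (translate b (chartTransform q j F))` is the tree's typed
  step (the cleaning `x ↦ x + h(y)` realised by `PointBlowupShade.exists_add_pow_eq_deletePthPowers`);
* if moreover `g ∈ 𝔪_{B'}^q` (order `≥ q` upstairs) then `b` is an EQUIMULTIPLE point
  (`IsEquimultiplePoint q j b s`) and `F'` again has order `≥ q`.

References: Hauser2010 §§F–G (chart expressions of a point blow-up, cleaning); CossartPiltant2019 §2.2;
NovacoskiSpivakovsky2014 Def. 2.11 (certificates of local blow-ups inside a field).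

The module is landed in four slices `Theorems.FrameStep1…4` (`frame_step` itself is in `Theorems.FrameStep4`).
Slice 1 (this file): the blow-up substitutions `blowSubst` on `K[Z,u]` and their effect on monomials,
on `rename some F` (`= u_j^q · chartTransform`, `= Z^q · zChartResidual`), localisation of the image and
injectivity transfer; the maximal ideal `𝔫 = (Z,u)` via `constantCoeff`.
-/

set_option linter.dupNamespace false

open MvPolynomial
open Literature.AlgebraicGeometry.Resolution
open Literature.AlgebraicGeometry.Resolution.Hauser2010
open Literature.AlgebraicGeometry.Resolution.PointBlowup

namespace Summit.ResolutionOfSingularities.ResolutionOfSingularities.Theorems.FrameStep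

noncomputable section

variable {σ : Type} [Fintype σ] [DecidableEq σ] {K : Type} [Field K]


/-! ## §1 The polynomial side: blow-up substitutions on `K[Z,u]` -/

/-- The blow-up substitution of the `o₀`-chart of the point blow-up of the origin of `K[Z,u]`:
`X o₀ ↦ X o₀`, `X o ↦ X o₀ · X o` (`o ≠ o₀`) (pull-back of functions to the chart).  DEFINITION (support).
[cite: Hauser2010, §F (chart expressions of a point blowup)] -/
def blowSubst (K : Type) [Field K] (o₀ : Option σ) :
    MvPolynomial (Option σ) K →ₐ[K] MvPolynomial (Option σ) K :=
  aeval fun o => if o = o₀ then X o₀ else X o₀ * X o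

omit [Fintype σ] in
/-- `blowSubst o₀ (X o₀) = X o₀`. -/
@[simp] theorem blowSubst_X_self (o₀ : Option σ) : blowSubst K o₀ (X o₀) = X o₀ := by
  simp [blowSubst]

omit [Fintype σ] in
/-- `blowSubst o₀ (X o) = X o₀ · X o` for `o ≠ o₀`. -/
theorem blowSubst_X_of_ne {o₀ o : Option σ} (h : o ≠ o₀) : blowSubst K o₀ (X o) = X o₀ * X o := by
  simp [blowSubst, h]

/-- Exponent bookkeeping of the blow-up substitution on a monomial:
`blowSubst o₀ (u^D) = (X o₀)^{|D| − D o₀} · u^D`. -/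
theorem blowSubst_monomial (o₀ : Option σ) (D : Option σ →₀ ℕ) (a : K) :
    blowSubst K o₀ (monomial D a) = X o₀ ^ (D.degree - D o₀) * monomial D a := by
  rw [blowSubst, aeval_monomial, Finsupp.prod_fintype _ _ (fun o => pow_zero _)]
  have hg : ∀ o, (if o = o₀ then X o₀ else X o₀ * X o : MvPolynomial (Option σ) K) ^ (D o)
      = X o₀ ^ (if o = o₀ then 0 else D o) * X o ^ (D o) := by
    intro o
    by_cases h : o = o₀
    · subst h; simp
    · rw [if_neg h, if_neg h, mul_pow]
  simp_rw [hg]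
  rw [Finset.prod_mul_distrib, Finset.prod_pow_eq_pow_sum]
  have hsum : (∑ o, if o = o₀ then 0 else D o) = D.degree - D o₀ := by
    have h1 : (∑ o, if o = o₀ then 0 else D o) + D o₀ = D.degree := by
      rw [Finsupp.degree_eq_sum]
      have h2 : (∑ o, if o = o₀ then D o else 0) = D o₀ := by
        rw [Finset.sum_ite_eq' Finset.univ o₀ (fun o => D o), if_pos (Finset.mem_univ _)]
      rw [← h2, ← Finset.sum_add_distrib]
      exact Finset.sum_congr rfl fun o _ => by by_cases h : o = o₀ <;> simp [h]
    omega
  have hmon : (∏ o, (X o : MvPolynomial (Option σ) K) ^ D o) = monomial D 1 := by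
    rw [← prod_X_pow_eq_monomial, ← Finsupp.prod_fintype D (fun o k => X o ^ k) (fun o => pow_zero _)]
    rfl
  rw [hsum, hmon, MvPolynomial.algebraMap_eq, ← mul_assoc, mul_comm (C a), mul_assoc, C_mul_monomial, mul_one]

/-- **The chart identity on monomials**: in the `u_j`-chart, `u^d ∘ (blow-up) = u_j^q · u^{d'}` with
`d' = chartExponent q j d` when `q ≤ |d|`. [cite: Hauser2010, §F (chart expressions of a point blowup)] -/
theorem blowSubst_rename_monomial (j : σ) (d : σ →₀ ℕ) (a : K) (q : ℕ) (hq : q ≤ d.degree) :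
    blowSubst K (some j) (rename some (monomial d a))
      = X (some j) ^ q * rename some (monomial (chartExponent q j d) a) := by
  rw [rename_monomial, rename_monomial, blowSubst_monomial, Finsupp.degree_mapDomain,
    Finsupp.mapDomain_apply (Option.some_injective σ), X_pow_eq_monomial, X_pow_eq_monomial, monomial_mul,
    monomial_mul, one_mul]
  have hj : d j ≤ d.degree := Finsupp.le_degree j d
  have hnone : (none : Option σ) ∉ Set.range (some : σ → Option σ) := by
    rintro ⟨m, hm⟩
    exact Option.some_ne_none m hm
  have hE : Finsupp.single (some j) (d.degree - d j) + Finsupp.mapDomain some d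
      = Finsupp.single (some j) q + Finsupp.mapDomain some (chartExponent q j d) := by
    ext o
    rcases o with _ | m
    · rw [Finsupp.add_apply, Finsupp.add_apply, Finsupp.mapDomain_notin_range _ _ hnone,
        Finsupp.mapDomain_notin_range _ _ hnone]
      simp
    · rw [Finsupp.add_apply, Finsupp.add_apply, Finsupp.mapDomain_apply (Option.some_injective σ),
        Finsupp.mapDomain_apply (Option.some_injective σ)]
      by_cases h : m = j
      · subst h
        simp [chartExponent]
        omega
      · simp [chartExponent, h]
  rw [hE]

/-- **The chart identity**: `F(…, u_m u_j, …, u_j, …) = u_j^q · chartTransform q j F` in `K[Z,u]`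
when every monomial of `F` has degree `≥ q`. [cite: Hauser2010, §F (chart expressions of a point blowup)] -/
theorem blowSubst_rename_eq (j : σ) (q : ℕ) (F : MvPolynomial σ K) (hF : ∀ d ∈ F.support, q ≤ d.degree) :
    blowSubst K (some j) (rename some F) = X (some j) ^ q * rename some (chartTransform q j F) := by
  conv_lhs => rw [F.as_sum]
  rw [map_sum, map_sum, chartTransform, map_sum, Finset.mul_sum]
  exact Finset.sum_congr rfl fun d hd => blowSubst_rename_monomial j d _ q (hF d hd)

/-- The residual of `F` in the (excluded) `Z`-chart: `Σ_d a_d Z^{|d|−q} u^d`.  DEFINITION (support). -/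
def zChartResidual (q : ℕ) (F : MvPolynomial σ K) : MvPolynomial (Option σ) K :=
  ∑ d ∈ F.support, monomial (d.mapDomain some + Finsupp.single none (d.degree - q)) (coeff d F)

/-- **The `Z`-chart identity**: `F(Z u) = Z^q · zChartResidual q F` when every monomial of `F` has degree `≥ q`.
[cite: Hauser2010, §F (chart expressions of a point blowup)] -/
theorem blowSubst_none_rename_eq (q : ℕ) (F : MvPolynomial σ K) (hF : ∀ d ∈ F.support, q ≤ d.degree) :
    blowSubst K none (rename some F) = X none ^ q * zChartResidual q F := by
  conv_lhs => rw [F.as_sum]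
  rw [map_sum, map_sum, zChartResidual, Finset.mul_sum]
  refine Finset.sum_congr rfl fun d hd => ?_
  rw [rename_monomial, blowSubst_monomial, Finsupp.degree_mapDomain, Finsupp.mapDomain_notin_range _ _ (by simp),
    Nat.sub_zero, X_pow_eq_monomial, X_pow_eq_monomial, monomial_mul, monomial_mul, one_mul]
  have hqd := hF d hd
  have hnone : (none : Option σ) ∉ Set.range (some : σ → Option σ) := by
    rintro ⟨m, hm⟩
    exact Option.some_ne_none m hm
  have hE : Finsupp.single none d.degree + Finsupp.mapDomain some d
      = Finsupp.single none q + (Finsupp.mapDomain some d + Finsupp.single none (d.degree - q)) := by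
    ext o
    rcases o with _ | m
    · rw [Finsupp.add_apply, Finsupp.add_apply, Finsupp.add_apply, Finsupp.mapDomain_notin_range _ _ hnone]
      simp
      omega
    · rw [Finsupp.add_apply, Finsupp.add_apply, Finsupp.add_apply, Finsupp.mapDomain_apply (Option.some_injective σ)]
      simp
  rw [hE]

omit [Fintype σ] [DecidableEq σ] in
/-- The `Z`-chart residual has no constant term (for `q ≥ 1`). -/
theorem zChartResidual_mem (q : ℕ) (hq : 1 ≤ q) (F : MvPolynomial σ K) (hF : ∀ d ∈ F.support, q ≤ d.degree) :
    zChartResidual q F ∈ idealOfVars (Option σ) K := by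
  refine Submodule.sum_mem _ fun d hd => ?_
  rw [← pow_one (idealOfVars (Option σ) K), monomial_mem_pow_idealOfVars_iff _ _ (mem_support_iff.mp hd)]
  have h1 : 1 ≤ d.degree := le_trans hq (hF d hd)
  rw [map_add, Finsupp.degree_mapDomain]
  omega

/-- Saturation: `(X o₀)^N · P` lies in the image of the blow-up substitution for `N` large. -/
theorem exists_X_pow_mul_mem_range (o₀ : Option σ) (P : MvPolynomial (Option σ) K) :
    ∃ N : ℕ, X o₀ ^ N * P ∈ (blowSubst K o₀).range := by
  obtain ⟨N, hN⟩ : ∃ N : ℕ, ∀ E ∈ P.support, Finsupp.degree E ≤ N :=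
    ⟨P.support.sup Finsupp.degree, fun E hE => Finset.le_sup (f := Finsupp.degree) hE⟩
  refine ⟨N, ?_⟩
  have hP : X o₀ ^ N * P = ∑ E ∈ P.support, X o₀ ^ N * monomial E (coeff E P) := by
    conv_lhs => rw [P.as_sum]
    rw [Finset.mul_sum]
  rw [hP]
  refine Subalgebra.sum_mem _ fun E hE => ?_
  have hle : E.degree - E o₀ ≤ N := le_trans (Nat.sub_le _ _) (hN E hE)
  refine ⟨X o₀ ^ (N - (E.degree - E o₀)) * monomial E (coeff E P), ?_⟩
  change blowSubst K o₀ _ = _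
  rw [map_mul, map_pow, blowSubst_X_self, blowSubst_monomial, ← mul_assoc, ← pow_add, Nat.sub_add_cancel hle]

/-- **Injectivity transfer**: a `K`-algebra map out of `K[Z,u]` whose composite with a blow-up substitution
is injective is injective (`K[Z,u] → K[Z,u][1/X o₀]` is injective and the substitution becomes onto after
inverting `X o₀`). -/
theorem injective_of_comp_blowSubst {A : Type} [CommRing A] [IsDomain A] [Algebra K A] (o₀ : Option σ)
    (θ' : MvPolynomial (Option σ) K →ₐ[K] A) (h : Function.Injective (θ'.comp (blowSubst K o₀))) :
    Function.Injective θ' := by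
  refine (injective_iff_map_eq_zero θ').mpr fun P hP => ?_
  obtain ⟨N, Q, hQ⟩ := exists_X_pow_mul_mem_range (K := K) o₀ P
  have hQ' : blowSubst K o₀ Q = X o₀ ^ N * P := hQ
  have hQ0 : Q = 0 := (injective_iff_map_eq_zero _).mp h Q (by
    rw [AlgHom.comp_apply, hQ', map_mul, map_pow, hP, mul_zero])
  rw [hQ0, map_zero] at hQ'
  exact (mul_eq_zero.mp hQ'.symm).resolve_left (pow_ne_zero _ (X_ne_zero _))

/-- `𝔫 = (Z, u)` is the kernel of the constant coefficient. -/
theorem mem_idealOfVars_iff {τ : Type} (P : MvPolynomial τ K) : P ∈ idealOfVars τ K ↔ constantCoeff P = 0 := by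
  have h := mem_pow_idealOfVars_iff' (R := K) (σ := τ) 1 P
  rw [pow_one] at h
  rw [h, constantCoeff_eq]
  constructor
  · intro h'
    exact h' 0 (by simp)
  · intro h' x hx
    have hx0 : x = 0 := (Finsupp.degree_eq_zero_iff x).mp (by omega)
    subst hx0
    exact h'

/-- `𝔫 = (Z, u)` is a maximal ideal of `K[Z,u]`. -/
theorem idealOfVars_isMaximal {τ : Type} : (idealOfVars τ K).IsMaximal := by
  have h : idealOfVars τ K = RingHom.ker (constantCoeff : MvPolynomial τ K →+* K) := by
    ext P
    rw [mem_idealOfVars_iff, RingHom.mem_ker]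
  rw [h]
  exact RingHom.ker_isMaximal_of_surjective _ fun a => ⟨C a, constantCoeff_C (σ := τ) a⟩

/-- Outside `𝔫` the constant coefficient is non-zero. -/
theorem constantCoeff_ne_zero_of_not_mem {τ : Type} {P : MvPolynomial τ K} (hP : P ∉ idealOfVars τ K) :
    constantCoeff P ≠ 0 := fun h => hP ((mem_idealOfVars_iff P).mpr h)

end

end Summit.ResolutionOfSingularities.ResolutionOfSingularities.Theorems.FrameStep
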